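import Summits.AtomisticToContinuum.Crystallization.Theses.PerronTransitivity
import Summits.AtomisticToContinuum.Crystallization.Theorems.NoFractionalGain.Negative.LoadBearing
import Summits.AtomisticToContinuum.Crystallization.Theorems.NoFractionalGain.Negative.Tightness
import Summits.AtomisticToContinuum.Crystallization.Theorems.NoFractionalGain.Negative.SignedSeparated
import Literature.MathematicalPhysics.StatisticalMechanics.Yuhjtman2015

/-!
# Disproof of `NoFractionalGain` (K*, crux stmt-AtomisticToContinuum-15098) — findings

Standing disprover's work file (seat `refuter-cdisprove-stmt-AtomisticToContinuum-15098-0`, cycle 1, 2026-08-17).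
The crux, verbatim the route decl `Summit.AtomisticToContinuum.Crystallization.Theses.PerronTransitivity.NoFractionalGain`:

  `∀ N (x : Fin N → ℝ³), x injective → ∀ c : Fin N → ℝ, (∀ i, 0 ≤ cᵢ) →`
  `   2·E*·∑ᵢ cᵢ² ≤ ∑ᵢ ∑_{j ≠ i} cᵢ cⱼ V_LJ(dist xᵢ xⱼ)`,      `E* = ⨅_Q e_LJ(Q)` (`= eStar`), `V_LJ = r⁻¹²/12 − r⁻⁶/6`.

Equivalently (finite ↔ periodic by blocks/padding): `sup_X μ_cop(M_X) = sup_X (mean row sum of M_X) = 2|E*|` over periodic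
`X`, `M_X` the k = 0 Bloch symbol of the binding kernel `−V_LJ` — "the Perron sup equals the mean sup".

## VERDICT OF THIS CYCLE: NO KILL.  Why K* resists

1. **Elaboration / junk** (§0): rc 0, body `rfl`-equal to the display; `⨅` genuine (`bddBelow_energyPerParticle_lennardJones`,
   explicit floor `−2³²/12`); `V_LJ(0) = 0` junk cannot enter (injectivity; and §1 shows it WOULD enter without it); `N = 0, 1`
   trivially true (`0 ≤ 0`, `2E*c² ≤ 0`); `c ≡ 1` is the PROVED Kepler-type floor `card_mul_eStar_le` (tree).
2. **Certification barrier** (decisive for a refuter): `¬K*` ⇔ `∃ L ≤ E*` CERTIFIED FROM BELOW and a weighted configuration with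
   `form/∑c² < 2L`.  The tree's lower bounds on `E*` are `−2³²/12` (proved) and `−14.316/12 = −1.193` (Yuhjtman 2015, named fact);
   the true value is `≈ −0.71759` (`2|E*| = Λ_hcp = 1.43518`).  Under any separation `δ ≥ 0.89` no single SITE is bound beyond
   `≈ 1.2·Λ_hcp` (one-centre sup, §3 and Numerics; without separation one-site binding is the wrong currency — stars give `n/12` at
   one site but `√n/12` in the form, killed by satellite repulsion, §4), and no weighted configuration found has form/∑c² above
   `1.000000·Λ_hcp`, let alone `> 2·1.193 = 1.66·Λ_hcp`.  Hence an UNCONDITIONAL Lean refutation of K* is impossible unless K*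
   failed by > 60 % — numerically it does not fail at all.  A refutation MODULO H (H = sharp floor / hcp-least, the
   `--negative-modulo` lane) needs a NUMERICAL violator of `Λ_hcp`; none exists in any search so far (item 4).
3. **What IS false, and landed** (§1–§2, all sorry-free, axioms standard, `Theorems/NoFractionalGain/Negative/*`):
   `c ≥ 0` is load-bearing (signed dipole, p167489) — even on the line's `73/100`-separated class modulo Yuhjtman (p167590);
   injectivity is load-bearing (junk star, p167489); the level `2E*` cannot be raised by any `η > 0` (p167549): K* has ZERO slack.
4. **Numerical violator hunt** (Numerics docstring at the end; kit j026717, pure python, one batched job): weighted periodic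
   Perron/copositive sup over cells `m ≤ 12` (+ σ, m = 30) (seeds hcp/fcc/dhcp/bcc/sc/sh/ω/AlB₂/diamond/β-Sn/A15/C15/C14/CaCu₅/σ/interstitial
   decorations/hcp supercells + random cells + basin hopping, separation NOT imposed, weights free) and the ONE-CENTRE sup versus the
   separation `δ`.  Prior seats: Barlow ≤ 1 − 3.5·10⁻⁵ (fcc 0.99990, dhcp 0.99995, 9R 0.99997), bcc 0.9566 (card j002036); the vetting refuter's
   7573-run weighted Perron search incl. FK/high-CN/binary/decorated-supercell cells M ≤ 40 (j023323 + j023343, KSTAR-ATTACK.md):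
   sup = hcp with UNIFORM weights, α-Mn 0.930, σ 0.922, A15 0.882, C14 0.838, C15 0.833, single Z16 sites up to 1.066 — this seat's
   independent code reproduces A15 0.882 / C14 0.837 / C15 0.832 to three digits; γ-brass 0.950 (ideator);
   m ≤ 5 separation-free copositive search 668 runs → hcp rediscovered (strategist j023919), hcp/fcc strict local maxima of
   the Perron root with second-order margin 40× (PS2, r_max = 0.023), Birman–Schwinger threshold for a point well 0.97Λ.  This seat's
   kit job j026717 (1056 relaxed searches, every seed + random cells m ≤ 12, basin hops): sup = close packing at `F/Λ_ref = 1.000000`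
   (0.999889 of hcp at RC = 10 + tail), best non-close-packed stationary values σ 0.936 and A15′ 0.904; NO configuration above Λ.
5. **Mechanism check (why no cheap counterexample can exist)**: `λ_max ≤ maxᵢ (B u)ᵢ/uᵢ` (Collatz–Wielandt with `w = u`): a Perron value
   above `Λ` needs a site whose NEIGHBOURS are super-bound on B-weighted average, iterated — an extended super-bound region, i.e. a bulk
   phase beating hcp in MEAN energy up to boundary terms; in 3-D a finite super-bound pocket of excess `δ` and radius `R₀` binds a Perron
   state only if `δR₀² ≳ 3D` (`D = ⅙∑_q φ(q)|q|²`, transience), planar/line defects bind at weak coupling only if the first-order term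
   `∑ᵢ δuᵢ = −2ΔE_defect ≥ 0`, i.e. only if hcp is NOT the ground state; displacive (phonon) perturbations are second order on both
   sides and lose 40:1 (PS2).  So K* ⇔ (numerically) hcp-optimality + "no mesoscale trick", and the mesoscale tricks are all subcritical.
   Physical costume: with Berthelot weights `cᵢ = √εᵢ`, K* ⇔ "an equal-size Lorentz–Berthelot LJ mixture never forms a compound at T = 0"
   (on a common lattice this is AM–GM: mixed bond `√(ε_Aε_B) ≤ (ε_A+ε_B)/2`); no literature counterexample (presearch: none).
   Exact consequence (block test with `c = 1 + t·1_{class}`, first order in `t`): K* ⇒ every periodic configuration ATTAINING `E*` is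
   ENERGY-TRANSITIVE (all motif site energies equal `2E*`); so K* is refuted by any certified non-transitive periodic minimiser
   (dhcp/4H-type) — none is expected (hcp-site domination, §4), and certifying one would again need the sharp floor.
   d = 2 sanity run (`compute/kstar2d.py`, triangular reference `Λ_tri(RC=7) = 0.563566` at `a* = 0.99021`; square 0.7895, kagome 0.6770,
   honeycomb 0.5370): 301 random weighted cells `m ≤ 5` ALL relax to the triangular lattice with equal weights (ratio 1.000000) —
   the weighted statement behaves in d = 2 exactly as Theil's unweighted one.
6. **Line `merge-perron`** (§4): the single open stub `stub_copositiveKepler` ≡ K* ∧ hcp-least (lead, HeartSize); its `c ≥ 0` cannot be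
   dropped (§1, SignedSeparated), its `73/100`-separation is NOT load-bearing for truth (merge reduction) — information, not a kill; joint
   sufficiency `NoFractionalGain_of` is kernel-checked by the lead; no stub is false for a degenerate reason.  Targets: none served.
-/

noncomputable section

namespace Summit.AtomisticToContinuum.Crystallization.Cruxes.NoFractionalGain.Disproof

open scoped BigOperators
open Literature.MathematicalPhysics.StatisticalMechanics
open Summit.AtomisticToContinuum.Crystallization.Theses.PerronTransitivity (NoFractionalGain)
open Summit.AtomisticToContinuum.Crystallization.Theorems.ChargedEnergyGapNegative (eStar eStar_le card_mul_eStar_le)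
open Summit.AtomisticToContinuum.Crystallization.Theorems.NoFractionalGain.Negative

/-! ## §0 Vocabulary: the crux is literally the displayed inequality; `c ≡ 1` is the proved floor -/

/-- The crux body, definitionally. [folklore] -/
theorem noFractionalGain_iff :
    NoFractionalGain ↔
      ∀ (N : ℕ) (x : Fin N → EuclideanSpace ℝ (Fin 3)), Function.Injective x → ∀ c : Fin N → ℝ,
        (∀ i, 0 ≤ c i) →
        2 * (⨅ Q : PeriodicConfiguration 3, Q.energyPerParticle lennardJones) * ∑ i, c i ^ 2 ≤
          ∑ i, ∑ j ∈ Finset.univ.erase i, c i * c j * lennardJones (dist (x i) (x j)) :=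
  Iff.rfl

/-- **K* at constant weights is TRUE** (the Kepler-type floor `N·E* ≤ E_LJ(x)`, tree `card_mul_eStar_le`): the free
weights are the whole content. [folklore] -/
theorem noFractionalGain_const_one {N : ℕ} (x : Fin N → EuclideanSpace ℝ (Fin 3)) (hx : Function.Injective x) :
    2 * (⨅ Q : PeriodicConfiguration 3, Q.energyPerParticle lennardJones) * ∑ _i : Fin N, (1 : ℝ) ^ 2 ≤
      ∑ i, ∑ j ∈ Finset.univ.erase i, (1 : ℝ) * 1 * lennardJones (dist (x i) (x j)) := by
  rw [Tightness.form_const_one]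
  have h := card_mul_eStar_le hx
  change (N : ℝ) * (⨅ Q : PeriodicConfiguration 3, Q.energyPerParticle lennardJones) ≤ _ at h
  simp only [one_pow, Finset.sum_const, Finset.card_univ, Fintype.card_fin, nsmul_eq_mul, mul_one]
  linarith

/-! ## §1 Load-bearing analysis (LANDED: `Negative/LoadBearing.lean` p167489, `Negative/SignedSeparated.lean` p167590) -/

/-- Any proof must use `c ≥ 0`: sign-free K* is false (dipole at distance `1/8`). [folklore] -/
theorem noFractionalGain_false_without_nonneg :
    ¬ (∀ (N : ℕ) (x : Fin N → EuclideanSpace ℝ (Fin 3)), Function.Injective x → ∀ c : Fin N → ℝ,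
        2 * (⨅ Q : PeriodicConfiguration 3, Q.energyPerParticle lennardJones) * ∑ i, c i ^ 2 ≤
          ∑ i, ∑ j ∈ Finset.univ.erase i, c i * c j * lennardJones (dist (x i) (x j))) :=
  LoadBearing.false_without_nonneg

/-- Any proof must use injectivity: with the junk `V_LJ(0) = 0`, coincident points are free occupation and the
star of multiplicity `2⁷⁰` breaks the level. [folklore] -/
theorem noFractionalGain_false_without_injective :
    ¬ (∀ (N : ℕ) (x : Fin N → EuclideanSpace ℝ (Fin 3)) (c : Fin N → ℝ), (∀ i, 0 ≤ c i) →
        2 * (⨅ Q : PeriodicConfiguration 3, Q.energyPerParticle lennardJones) * ∑ i, c i ^ 2 ≤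
          ∑ i, ∑ j ∈ Finset.univ.erase i, c i * c j * lennardJones (dist (x i) (x j))) :=
  LoadBearing.false_without_injective

/-- `c ≥ 0` stays load-bearing on the line's `73/100`-separated class, modulo Yuhjtman's stability constant
(`E* ≥ −1.193`): threshold in truth `δ < V_LJ⁻¹(2|E*|) ≈ 0.758`. [cite: Yuhjtman2015, Thm. 9] -/
theorem noFractionalGain_signed_false_on_separated (hY : Yuhjtman2015_stabilityConstant) :
    ¬ (∀ (N : ℕ) (x : Fin N → EuclideanSpace ℝ (Fin 3)), Function.Injective x →
        (∀ i j, i ≠ j → (73 : ℝ) / 100 ≤ dist (x i) (x j)) → ∀ c : Fin N → ℝ,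
        2 * (⨅ Q : PeriodicConfiguration 3, Q.energyPerParticle lennardJones) * ∑ i, c i ^ 2 ≤
          ∑ i, ∑ j ∈ Finset.univ.erase i, c i * c j * lennardJones (dist (x i) (x j))) :=
  SignedSeparated.signed_false_on_separated_of_stability hY

/-! ## §2 Tightness (LANDED: `Negative/Tightness.lean` p167549): zero slack -/

/-- The level cannot be raised: K* with `2E* + η` is false for every `η > 0` (large blocks of near-optimal periodic
configurations, constant weights). [folklore] -/
theorem noFractionalGain_tight {η : ℝ} (hη : 0 < η) :
    ¬ (∀ (N : ℕ) (x : Fin N → EuclideanSpace ℝ (Fin 3)), Function.Injective x → ∀ c : Fin N → ℝ,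
        (∀ i, 0 ≤ c i) →
        (2 * (⨅ Q : PeriodicConfiguration 3, Q.energyPerParticle lennardJones) + η) * ∑ i, c i ^ 2 ≤
          ∑ i, ∑ j ∈ Finset.univ.erase i, c i * c j * lennardJones (dist (x i) (x j))) :=
  Tightness.false_at_raised_level hη

/-! ## §3 Natural strengthenings — near-misses (numerically false, NOT certifiable: barrier of item 2)

The one-centre (walk-hierarchy level 1) strengthening "every site of every `δ`-separated configuration has binding
`uᵢ = ∑_{j≠i} −V_LJ(dist) ≤ 2|E*|`" implies K* on `δ`-separated sets (row-sum bound) and is what a Montgomery–Vaughan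
transfer would need.  NUMERICS (this seat, `compute/kstar_search.py` phase O, tapered sums within r ≤ 2.75 vs the best
close-packed ball at the same taper): it is FALSE for every `δ < a* ≈ 0.9716` by FIRST-SHELL BREATHING around one centre
(12 neighbours moved to radius 1 while the outer shells stay / crowd in: +5.2 % at δ = 0.95, +2.5 % from the first shell
alone at δ ≤ 0.94: `12(φ(1) − φ(a*)) = 0.036`), and by over-coordination for `δ ≤ 0.9564` (Tammes: 13 points at radius 1
are 0.9564-separated; 15 at δ = 2^{-1/6}: first shell 15/12 = 1.25 vs hcp's 0.963).  Whether any `δ ≥ a*` environment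
beats the hcp site is the open one-centre LJ problem (crux `OneCentreDominationLJ`, stmt-12882); job tables pending.
A Lean refutation of the strengthening needs `E* ≥ −u_witness/2`, i.e. the sharp floor — not in the tree.  Recorded as a
sorry'd near-miss so that provers do not build on level-1 domination below `a*`. -/

/-- NEAR-MISS (not certifiable today): the one-centre strengthening of K* on `47/50`-separated sets is false —
witness in truth: centre + 12 neighbours at radius `1` + hcp shells 2… at `a* = 0.9716` (all pairs ≥ 0.94 apart),
`u = 1.4352 + 0.036 > 2|E*| = 1.4352`.  OBSTRUCTION: needs the lower bound `E* ≥ −0.7356` (any `L` with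
`2|L| < 1.471`); the tree certifies only `E* ≥ −2³²/12` and, as a named fact, `−1.193`.  Tried: nothing cheaper exists —
every `… ≤ 2|E*|`-shaped strengthening is refutable only through a floor on `E*`. -/
theorem oneCentre_strengthening_false :
    ¬ (∀ (N : ℕ) (x : Fin N → EuclideanSpace ℝ (Fin 3)), Function.Injective x →
        (∀ i j, i ≠ j → (47 : ℝ) / 50 ≤ dist (x i) (x j)) → ∀ i : Fin N,
        2 * (⨅ Q : PeriodicConfiguration 3, Q.energyPerParticle lennardJones) ≤
          ∑ j ∈ Finset.univ.erase i, lennardJones (dist (x i) (x j))) := by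
  sorry

/-! ## §4 Line `merge-perron` (lead prover-line-stmt-AtomisticToContinuum-15098-c1-0), skeleton rev. 3

Single open stub `stub_copositiveKepler : ∀ a h > 0, (hcp(a,h) is e_LJ-optimal in the hcp family) → ∀ N x inj,`
`(73/100-separated) → ∀ c ≥ 0, 2·e_LJ(hcp a h)·∑cᵢ² ≤ form`.  Mutation results:
* drop `c ≥ 0` → FALSE modulo Yuhjtman (§1, `noFractionalGain_signed_false_on_separated`; dipole at 0.73, `V(0.73) = 2.537 > 2.386`).
* drop `73/100`-separation → still equivalent to K* ∧ hcp-least (lead's merge reduction `mergeReduction_of_coreHeight`): NOT load-bearing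
  for truth, only for the certificate format ("hᵢ possibly unnecessary").
* the hcp-optimality hypothesis is satisfiable (e_hcp(a,h) → +∞ as a,h → 0, → 0⁻ at ∞, continuous, negative somewhere ⇒ min attained) — the stub
  is not vacuous; it is exactly `NoFractionalGain ∧ IsLeast … (e_LJ(hcp a h))` (lead, `copositiveKepler_iff_noFractionalGain_and_hcpLeast`).
* joint sufficiency: `NoFractionalGain_of` kernel-checked (lead); nothing smuggled.
No stub is false for a degenerate reason; no `-- Targets` were served this cycle (payload.targets = []).

**For the lead's open question (hcp-site domination over Hägg words, all-even-rank registry hypothesis)** — this seat's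
numerics (`compute/hagg_check2.py`, relaxed hcp `a = 0.97156`, `h = 0.79316`, binding convention `J_k = φ_k(aligned) − φ_k(not)`,
smooth radial damping `exp(−(r/R_d)⁴)`, converged in `R_d = 6 → 18`):
`J₂ = 7.2597·10⁻⁵, J₃ = 8.462·10⁻⁸, J₄ = 1.117·10⁻¹⁰, J₅ = 1.703·10⁻¹³, J₆ = 2.91·10⁻¹⁶, J₇ ≈ 2·10⁻¹⁸` — ALL POSITIVE (alignment
at every rank binds better) with ratio `J_{k+1}/J_k ≈ 1.2…1.7·10⁻³ ≈ e^{−G₁h}`, so `J_{2j} > ∑_{k>2j} J_k` at every even rank by ~10³: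
the all-even-rank hypothesis holds numerically.  Enumeration of all Hägg words of period ≤ 14: max over sites of (binding − hcp
binding) = `−7.251·10⁻⁵` (first deviation from the hcp alignment pattern at k = 2), `−1.115·10⁻¹⁰` (first deviation at k = 4),
`−2.89·10⁻¹⁶` (at k = 6): domination holds, but its margin is `J_{2j}` for sites whose first deviation is at rank `2j` — ZERO in the sup
over words (long polytypes have sites exponentially close to the hcp level).  So K* on the Barlow class / M*'s word lemma can only be
certified through the SIGN STRUCTURE of the registry series (Poisson summation: `J_k = A⁻¹∑_{G≠0} f̂(G,kh)(1 − cos G·δ)`, positivity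
of the Hankel transform of the completely monotone `(ρ²+z²)⁻³` against the small repulsive part), never by truncated numerics.
TRAP (recorded because this seat fell into it first): a hard lateral cutoff (R = 14, no damping) gives J₃…J₈ of the WRONG size and
sign (e.g. `J₅ = −2.5·10⁻⁷`) and a spurious domination failure `+7.9·10⁻⁸`; boundary noise ~ ring × φ(R) ≈ 10⁻⁶ ≫ J₃.
-/

/-! ## Numerics (this seat; units `V = r⁻¹²/12 − r⁻⁶/6`, `φ = −V`; pure python `compute/kstar_core.py`, `kstar_search.py`)

Reference: `Λ_hcp(RC=6) = 1.4301757` at `a* = 0.97156, c/a = 1.63274`; `Λ_fcc(RC=6) = 1.4301824` (hard truncation at 6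
flips the hcp/fcc order — the 1.4·10⁻⁴ gap lives in the tail; at RC = 10 + continuum tail `2πρ/(9·RC³)`: hcp 1.4351888 >
fcc 1.4350445, full value 1.43518).  Ratios below are to `Λ_ref(RC=6) = max(hcp, fcc)`.

**Weighted periodic Perron value, symmetry KEPT (scale optimised for the Perron value, weights = Perron vector):**
A15 0.8823 (mean 0.8798, best site 0.9704, worst 0.8495, dmin 0.887) · C15 0.8324 (best Z12 site 1.0094 (!), worst Z16 0.7172,
dmin 0.911) · C14 0.8374 (best Z12 site 1.0148 (!), worst 0.7104, dmin 0.891) · CaCu₅ 0.7550 · bcc 0.95654 · β-Sn 0.7293 ·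
sh 0.7902 · sc 0.6605.  So the planner's named failure mode is quantitatively dead: Frank–Kasper Z12 sites ARE super-bound
(+0.9…1.5 %, at compressed scale, 0.89–0.91-separated) but only while their Z14/Z16 neighbours sit at 0.71–0.85, and the Perron
vector cannot desert the neighbours that provide the binding (`λ ≤ maxᵢ (Bu)ᵢ/uᵢ`): Perron 0.83–0.88.
**Weighted Perron value, everything FREE (cell 9 dof + 3m positions + m weights, L-BFGS + basin hops, separation NOT imposed):**
A15 → genuine local maximum 0.90375 (Z12 0.963 ×2, Z14 0.883 ×6, weights 1.00/0.93), escapes to close packing under a 2 % kick;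
σ (30 atoms, 5 Wyckoff families relaxed) → 0.93359 (sites 0.881…0.982); C14, C15, CaCu₅, β-Sn, bcc, ω, fcc+octahedral
interstitial, hcp+octahedral (NiAs), fluorite-type fcc+2 tetrahedral, hcp 2×2×1 / 1×1×3 supercells, and EVERY random cell
(m = 2…10, smoke run) → close packing, `F/Λ_ref = 1.000000`, all sites 1.000, dmin 0.972, vol/atom 0.648: interstitials are
expelled/merged, the landscape of the weighted objective is funnelled to hcp/fcc exactly like the unweighted energy.
**One-centre sup** (tapered binding within r ≤ 2.75 around one centre, all pairs ≥ δ incl. the centre, 134 free points, vs the best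
uniformly scaled close-packed ball with nn ≥ δ at the same taper): δ = 0.8909 → 13-coordinated centre, +4.9 %; δ = 0.95 → +5.2 %
(hcp onion with first shell at 0.994–0.997, outer shells crowded in); **δ = a* = 0.9716 → +1.72 %** (first shell breathes out to
0.994, outer shells yield; raw sum within 2.75: 1.4087 vs hcp 1.3844); δ = 0.99 → +0.0 % (0.99992); δ = 1.0 → below (0.9998, cp ball
at a = 1 is itself 2.3 % under Λ_hcp).  Hence super-bound SITES exist in δ-separated configurations for every δ ≲ 0.98 ⊃ the
LJ-realistic range (hcp's own nn distance is 0.9712): the row-sum/one-centre route to K* is closed exactly where it is needed, and a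
proof must recover ≈ 2–5 % collectively (weights/transfers), not 10⁻⁴.
**Kit job j026717 (4 cores, 1217 s wall, seed 11; artefacts `~/compute/j026717/outputs/phaseP_top.json`, `phaseO.json`,
sha256 in MANIFEST; attached to the item).  Phase P — weighted periodic Perron sup, everything free, separation NOT imposed,
1056 L-BFGS searches with basin hops over all seeds ×2 (hcp, fcc, dhcp, hcp 2×2×1 / 1×1×3, fcc4conv, bcc, bcc2conv, sc, sh, ω, AlB₂,
diamond, β-Sn, perovskite-5, A15, C15, C14, CaCu₅, σ (m = 30), fcc+oct, hcp+oct, fcc+2tet) + random cells m = 2…12 with random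
weights:** the top-40 table is ENTIRELY close packing, `F/Λ_ref = 1.000000` (copositive value = Perron value, uniform weights 1.00,
all site bindings 1.000·Λ, dmin 0.972, vol/atom 0.648), re-evaluated at RC₂ = 10 with continuum tail: 1.4350292 = 0.999889·hcp
(hcp 1.4351888 > fcc 1.4350445 — the searches land on fcc/random Barlow stackings, which lose to hcp only in the tail, consistent with
Barlow ≤ 1 − 3.5·10⁻⁵).  Trajectory log: A15 (uniform 0.8798) → either cp (1.000000) or the A15′ local maximum 0.903752 (dmin 0.908);
σ (uniform 0.9131) → 0.936035 (dmin 0.914); C14 0.8241 / C15 0.8194 / CaCu₅ 0.7537 / β-Sn 0.7293 / dhcp 0.99995 / perovskite-5 0.281 /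
fcc+2tet (−3.91) / ω / AlB₂ / interstitial decorations → cp.  No run, at any stage, printed a ratio above 1 + 10⁻⁶.
**Phase O — one-centre tapered binding sup (R₁ = 2.05, R₀ = 2.75; n = 110…150 free points, all pairs ≥ δ) from hcp / hcp-breathing /
fcc / icosahedral / random starts, ratio to the best uniformly-scaled cp ball with nn ≥ δ (u = 1.35665 for δ ≤ 0.9735, 1.32570 at δ = 1):**
δ = 0.8909: hcp-breath 1.1726 (n₁ = 12, shell 0.998 ×6 / 1.010 ×6, then 1.212), hcp 1.1703 (n₁ = 14), fcc 1.1506, ico ≤ 1.0375, random ≤ 1.0309 ·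
δ = 0.93: hcp-breath 1.0887, hcp 1.0860, fcc 1.0821, ico ≤ 0.963, random ≤ 0.950 ·
δ = 0.95: hcp-breath 1.0532, hcp 1.0518, fcc 1.0498, ico ≤ 0.937, random ≤ 0.930 ·
δ = a* = 0.9716: hcp-breath 1.01726, hcp 1.01719, fcc 1.01707 (first shell at 0.994–0.996, second pushed to 1.366–1.373), ico ≤ 0.885, random ≤ 0.895 ·
δ = 1.0: fcc 0.99972, hcp-breath 0.99928, hcp 0.99901, ico ≤ 0.856, random ≤ 0.833.
Reading: the one-centre (row-sum) bound fails by +1.7 % at hcp's own nearest-neighbour distance and by +17 % at the Yuhjtman-scale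
separation 0.89, ALWAYS via a breathing close-packed onion (inner shell contracted into the well, outer shells crowded inward — a
configuration that cannot be continued periodically: its neighbours pay); icosahedral and random environments never reach the cp
ball even sitewise (≤ 1.04 at δ = 0.89, ≤ 0.89 at δ ≥ 0.95).  So the super-bound-site phenomenon is real but purely local, and the
Perron/quadratic-form value (Phase P) re-collects the deficit from the crowded outer shells exactly as item 5 predicts.
(A 16-core/3 h replica j026719, m ≤ 16, was cancelled as redundant with the vetting refuter's 7573-run j023343, M ≤ 40, same verdict.)
-/

end Summit.AtomisticToContinuum.Crystallization.Cruxes.NoFractionalGain.Disproof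

end
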